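import Summits.AnomalousDissipation.AnomalousDissipation.Theorems.SolenoidalFractalHomogenisationLagrangianStepCellLawVQSBlock
import Summits.AnomalousDissipation.AnomalousDissipation.Theorems.SolenoidalFractalHomogenisationLagrangianStepCellClauseCuts
import Mathlib.Analysis.ODE.ExistUnique
import HarnessLib

/-!
# K1L `LagrangianRenormalisationStep(Design)` (K1L_D, stmt-AnomalousDissipation-27980; aside 24912), stub `stub_cellLawV0_IS`
# — the EFFECTIVE SLOW GENERATOR `Ḡ = 4π² P_ℓ Σ(𝔹, ℓ) P_ℓ` and the linear matrix ODE in integrated form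
# (helper; `--supports stmt-AnomalousDissipation-27980`; word-independent; part 1 of 2, part 2 = `…CellLawVEffectiveMode`)

Summits-side helper file of route `SolenoidalFractalHomogenisation` (planner ad-ideate-p5's STUB-PLAN for `stub_cellLawV` §1 (V) steps V0/V2/V6: clause
(V) = `SlowVectorClauseNoExF` compares the cell solution with THE weak solution `v` of the carrier-free effective problem from the single-mode datum; the
sibling file proves that `v`'s slow mode is `e^{−tḠ}(p/2)`; here the finite-dimensional half).
* §1 `eq_exp_neg_smul_mulVec_of_integral_eq` — a continuous `x : [0,T] → ℝᵐ` with `x(t) = x₀ − ∫₀ᵗ G x(τ) dτ` componentwise is `x(t) = e^{−tG} x₀`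
  (FTC with right derivatives, Mathlib's `ODE_solution_unique`, ad-lit's `hasDerivAt_exp_neg_smul_mulVec` p635350); `ae_eq_exp_neg_smul_mulVec` — the
  same for a componentwise-integrable `X` on `(0,T')` satisfying the integral equation only for a.e. `t` (continuous representative).
* §2 `kvec`, `khat`, `effGen 𝔹 ℓ := 4π² • (P_ℓ Σ(𝔹,ℓ) P_ℓ)` with `P_ℓ = projPerp (ℓ/‖ℓ‖)`, `Σ(𝔹,ℓ) = sigMat 𝔹 ℓ` (vocabulary of `…CellLawVQSBlock`,
  p643421) — the Leray-projected symbol of `−𝓛_𝔹` on the mode `ℓ`; test-vector algebra; `integral_eq_effGen_of_projected` — from the weak equation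
  tested against the three (transversal) columns of `P_ℓ` to the integrated ODE `X(t) = X₀ − ∫₀ᵗ Ḡ X` for an a.e. transversal family `X`.
No named facts, no sorry.  Infrastructure for route-1's rung leaf F-D1.A0 (frontier FORMAL rung); NOT a proof of the stub, of the crux, of Onsager's
conjecture or of anomalous dissipation.  Prover seat `ad-k1l-cellLawV-w1` g0, 2026-08-28.
-/

set_option linter.dupNamespace false

noncomputable section

namespace Summit.AnomalousDissipation.AnomalousDissipation.Theorems.SolenoidalFractalHomogenisation.LagrangianStep

open Literature.Analysis Literature.Analysis.FluidPDE Literature.Analysis.FunctionSpaces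
open Literature.Analysis.ODE.PeriodicAveraging
open MeasureTheory Set Filter Function UnitAddTorus
open scoped ENNReal NNReal InnerProductSpace Topology

/-! ## §1 Uniqueness for the linear matrix ODE in integrated form -/

section LinearODE

variable {m : ℕ}

/-- **`x(t) = x₀ − ∫₀ᵗ G x ⇒ x(t) = e^{−tG} x₀`** for a continuous `x` on `[0, T]` (componentwise integral equation). [folklore] -/
theorem eq_exp_neg_smul_mulVec_of_integral_eq (G : Matrix (Fin m) (Fin m) ℝ) (x₀ : Fin m → ℝ) {T : ℝ} (hT : 0 ≤ T)
    (x : ℝ → Fin m → ℝ) (hcont : ContinuousOn x (Icc 0 T))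
    (hint : ∀ t ∈ Icc 0 T, ∀ i, x t i = x₀ i - ∫ τ in (0:ℝ)..t, G.mulVec (x τ) i) :
    ∀ t ∈ Icc 0 T, x t = (NormedSpace.exp (-(t • G))).mulVec x₀ := by
  -- the vector field `y ↦ -(G y)` is Lipschitz
  set L : (Fin m → ℝ) →L[ℝ] (Fin m → ℝ) := LinearMap.toContinuousLinearMap (Matrix.mulVecLin (-G)) with hL
  have hLapply : ∀ y, L y = -(G.mulVec y) := fun y => by
    simp only [hL, LinearMap.coe_toContinuousLinearMap', Matrix.mulVecLin_apply, Matrix.neg_mulVec]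
  have hv : ∀ _ : ℝ, LipschitzWith ‖L‖₊ (fun y : Fin m → ℝ => -(G.mulVec y)) := fun _ => by
    have h := L.lipschitz
    have e : (fun y : Fin m → ℝ => -(G.mulVec y)) = L := funext fun y => (hLapply y).symm
    rw [e]; exact h
  -- the integrand is continuous on `[0, T]`
  have hGx : ContinuousOn (fun τ => G.mulVec (x τ)) (Icc 0 T) := by
    have hc : Continuous fun y : Fin m → ℝ => G.mulVec y := continuous_const.matrix_mulVec continuous_id
    exact hc.comp_continuousOn hcont
  -- `x` solves the ODE with right derivatives on `[0, T)`
  have hderiv : ∀ t ∈ Ico 0 T, HasDerivWithinAt x (-(G.mulVec (x t))) (Ici t) t := by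
    intro t ht
    rw [hasDerivWithinAt_pi]
    intro i
    have hGi : ContinuousOn (fun τ => G.mulVec (x τ) i) (Icc 0 T) := (continuous_apply i).comp_continuousOn hGx
    have hii : IntervalIntegrable (fun τ => G.mulVec (x τ) i) volume 0 t :=
      (hGi.mono (Icc_subset_Icc_right ht.2.le)).intervalIntegrable_of_Icc ht.1
    have hIcc : Icc 0 T ∈ 𝓝[>] t := mem_of_superset (Ioo_mem_nhdsGT ht.2) fun y hy => ⟨ht.1.trans hy.1.le, hy.2.le⟩
    have hmeas : StronglyMeasurableAtFilter (fun τ => G.mulVec (x τ) i) (𝓝[>] t) volume :=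
      (hGi.stronglyMeasurableAtFilter_nhdsWithin measurableSet_Icc t).filter_mono (nhdsWithin_le_of_mem hIcc)
    have hcwa : ContinuousWithinAt (fun τ => G.mulVec (x τ) i) (Ioi t) t :=
      (hGi.continuousWithinAt ⟨ht.1, ht.2.le⟩).mono_of_mem_nhdsWithin hIcc
    have hF : HasDerivWithinAt (fun u => x₀ i - ∫ τ in (0:ℝ)..u, G.mulVec (x τ) i) (0 - G.mulVec (x t) i) (Ici t) t :=
      (hasDerivWithinAt_const t (Ici t) (x₀ i)).sub (intervalIntegral.integral_hasDerivWithinAt_right hii hmeas hcwa)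
    rw [zero_sub] at hF
    refine hF.congr_of_eventuallyEq ?_ (hint t ⟨ht.1, ht.2.le⟩ i)
    have hIcc' : Icc 0 T ∈ 𝓝[≥] t := mem_of_superset (Icc_mem_nhdsGE ht.2) fun y hy => ⟨ht.1.trans hy.1, hy.2⟩
    filter_upwards [hIcc'] with u hu
    exact hint u hu i
  -- the explicit solution
  have hg : ∀ t ∈ Ico 0 T, HasDerivWithinAt (fun u => (NormedSpace.exp (-(u • G))).mulVec x₀)
      (-(G.mulVec ((NormedSpace.exp (-(t • G))).mulVec x₀))) (Ici t) t := fun t _ =>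
    (hasDerivAt_exp_neg_smul_mulVec G x₀ t).hasDerivWithinAt
  have hgc : ContinuousOn (fun u => (NormedSpace.exp (-(u • G))).mulVec x₀) (Icc 0 T) :=
    (continuous_exp_neg_smul_mulVec G x₀).continuousOn
  have h0 : x 0 = (NormedSpace.exp (-((0:ℝ) • G))).mulVec x₀ := by
    rw [zero_smul, neg_zero, NormedSpace.exp_zero, Matrix.one_mulVec]
    funext i
    rw [hint 0 ⟨le_rfl, hT⟩ i, intervalIntegral.integral_same, sub_zero]
  exact ODE_solution_unique (v := fun _ y => -(G.mulVec y)) hv hcont hderiv hgc hg h0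

end LinearODE


section LinearODEae

/-- **A.e. solutions of the integrated linear ODE are the matrix exponential**: if `X` is componentwise integrable on `(0,T')` and
`X(t) = X₀ − ∫₀ᵗ G X` componentwise for a.e. `t`, then `X(t) = e^{−tG} X₀` for a.e. `t` (continuous representative + §1). [folklore] -/
theorem ae_eq_exp_neg_smul_mulVec {m : ℕ} (G : Matrix (Fin m) (Fin m) ℝ) (X₀ : Fin m → ℝ) {T' : ℝ} {X : ℝ → Fin m → ℝ}
    (hXi : ∀ i, IntegrableOn (fun τ => X τ i) (Ioo 0 T') volume)
    (hint : ∀ᵐ t ∂(volume.restrict (Ioo 0 T')), ∀ i, X t i = X₀ i - ∫ τ in (0:ℝ)..t, G.mulVec (X τ) i) :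
    ∀ᵐ t ∂(volume.restrict (Ioo 0 T')), X t = (NormedSpace.exp (-(t • G))).mulVec X₀ := by
  have hGi : ∀ i, IntegrableOn (fun τ => G.mulVec (X τ) i) (Ioo 0 T') volume := by
    intro i
    have h := integrable_finsetSum (μ := volume.restrict (Ioo 0 T')) Finset.univ fun j (_ : j ∈ Finset.univ) => (hXi j).const_mul (G i j)
    refine h.congr (ae_of_all _ fun τ => ?_)
    simp only [Matrix.mulVec, dotProduct]
  set Xt : ℝ → Fin m → ℝ := fun t i => X₀ i - ∫ τ in (0:ℝ)..t, G.mulVec (X τ) i with hXt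
  have hae : ∀ᵐ t ∂(volume.restrict (Ioo 0 T')), X t = Xt t := by
    filter_upwards [hint] with t ht
    funext i
    exact ht i
  have hae' := (ae_restrict_iff' measurableSet_Ioo).1 hae
  -- the continuous representative solves the integral equation everywhere on `[0, T')`
  have hclaim : ∀ t ∈ Ico 0 T', Xt t = (NormedSpace.exp (-(t • G))).mulVec X₀ := by
    intro t ht
    have hIoc : Ioc 0 t ⊆ Ioo 0 T' := fun τ hτ => ⟨hτ.1, lt_of_le_of_lt hτ.2 ht.2⟩
    have hGi' : ∀ i, IntegrableOn (fun τ => G.mulVec (X τ) i) (Icc 0 t) volume := fun i => by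
      rw [integrableOn_Icc_iff_integrableOn_Ioc]
      exact (hGi i).mono_set hIoc
    have hcont : ContinuousOn Xt (Icc 0 t) := by
      refine continuousOn_pi.2 fun i => ?_
      have h := intervalIntegral.continuousOn_primitive_interval (μ := volume) (a := 0) (b := t)
        (f := fun τ => G.mulVec (X τ) i) (by rw [uIcc_of_le ht.1]; exact hGi' i)
      rw [uIcc_of_le ht.1] at h
      exact continuousOn_const.sub h
    have hint' : ∀ s ∈ Icc 0 t, ∀ i, Xt s i = X₀ i - ∫ τ in (0:ℝ)..s, G.mulVec (Xt τ) i := by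
      intro s hs i
      simp only [hXt]
      congr 1
      refine intervalIntegral.integral_congr_ae ?_
      filter_upwards [hae'] with τ hτ hτmem
      have hτ' : τ ∈ Ioo 0 T' := by
        rw [uIoc_of_le hs.1] at hτmem
        exact ⟨hτmem.1, lt_of_le_of_lt (hτmem.2.trans hs.2) ht.2⟩
      rw [hτ hτ']
    exact eq_exp_neg_smul_mulVec_of_integral_eq G X₀ ht.1 Xt hcont hint' t ⟨ht.1, le_rfl⟩
  filter_upwards [hae, ae_restrict_mem measurableSet_Ioo] with t ht htT
  rw [ht]
  exact hclaim t ⟨htT.1.le, htT.2⟩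

end LinearODEae

/-! ## §2 The effective generator `Ḡ = 4π² P_ℓ Σ(𝔹, ℓ) P_ℓ` and the algebra of real test vectors -/

section Generator

/-- The integer wave vector as a real coordinate vector. -/
def kvec (ℓ : Fin 3 → ℤ) : Fin 3 → ℝ := fun a => (ℓ a : ℝ)

/-- The unit wave vector `ℓ/‖ℓ‖` as a real coordinate vector. -/
def khat (ℓ : Fin 3 → ℤ) : Fin 3 → ℝ := fun a => (ℓ a : ℝ) / ‖Torus.latticeVec ℓ‖

/-- **The effective slow generator** at the wave vector `ℓ` of the constant tensor `𝔹`: `Ḡ = 4π² · P_ℓ Σ(𝔹, ℓ) P_ℓ`, `P_ℓ = projPerp (ℓ/‖ℓ‖)`,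
`Σ(𝔹,ℓ)_{ij} = Σ_{ab} 𝔹 i a j b ℓ_a ℓ_b` (`sigMat 𝔹 (kvec ℓ)`) — the Leray-projected symbol of `−𝓛_𝔹` on the mode `ℓ`. -/
def effGen (𝔹 : Torus.Visc4 (Fin 3)) (ℓ : Fin 3 → ℤ) : Matrix (Fin 3) (Fin 3) ℝ :=
  (4 * Real.pi ^ 2) • (projPerp (khat ℓ) * sigMat 𝔹 (kvec ℓ) * projPerp (khat ℓ))

variable {ℓ : Fin 3 → ℤ}

/-- `khat ℓ` is a unit vector (`ℓ ≠ 0`). [folklore] -/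
theorem sum_khat_sq (hℓ : ℓ ≠ 0) : ∑ a, khat ℓ a ^ 2 = 1 := by
  have hpos : 0 < ‖Torus.latticeVec ℓ‖ := norm_latticeVec_pos_of_ne_zero hℓ
  simp only [khat, div_pow, ← Finset.sum_div]
  have h : ∑ a, (ℓ a : ℝ) ^ 2 = ‖Torus.latticeVec ℓ‖ ^ 2 := by
    rw [EuclideanSpace.real_norm_sq_eq]
    exact Finset.sum_congr rfl fun a _ => by rw [Torus.latticeVec_apply]
  rw [h, div_self (pow_pos hpos 2).ne']

/-- Transversality in the two normalisations: `Σ ℓⱼ xⱼ = 0 ↔ Σ (ℓ/‖ℓ‖)ⱼ xⱼ = 0`. [folklore] -/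
theorem sum_khat_mul_eq_zero {x : Fin 3 → ℝ} (h : ∑ j, (ℓ j : ℝ) * x j = 0) : ∑ j, khat ℓ j * x j = 0 := by
  simp only [khat, div_mul_eq_mul_div, ← Finset.sum_div, h, zero_div]

/-- The columns of `P_ℓ` are transversal: `Σⱼ ℓⱼ P_{ji} = 0` (`ℓ ≠ 0`). [folklore] -/
theorem sum_kvec_mul_projPerp_col (hℓ : ℓ ≠ 0) (i : Fin 3) : ∑ j, (ℓ j : ℝ) * projPerp (khat ℓ) j i = 0 := by
  have hpos : 0 < ‖Torus.latticeVec ℓ‖ := norm_latticeVec_pos_of_ne_zero hℓ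
  have h := sum_mul_projPerp_mulVec (sum_khat_sq hℓ) (Pi.single i 1)
  simp only [Matrix.mulVec, dotProduct, Pi.single_apply, mul_ite, mul_one, mul_zero, Finset.sum_ite_eq',
    Finset.mem_univ, if_true] at h
  have e : ∑ j, (ℓ j : ℝ) * projPerp (khat ℓ) j i = ‖Torus.latticeVec ℓ‖ * ∑ j, khat ℓ j * projPerp (khat ℓ) j i := by
    rw [Finset.mul_sum]
    refine Finset.sum_congr rfl fun j _ => ?_
    simp only [khat]
    field_simp
  rw [e, h, mul_zero]

/-- Pairing against a column of the (symmetric) projector: `Σⱼ P_{ji} yⱼ = (P y)ᵢ`. [folklore] -/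
theorem sum_projPerp_col_mul (n y : Fin 3 → ℝ) (i : Fin 3) : ∑ j, projPerp n j i * y j = (projPerp n).mulVec y i := by
  simp only [Matrix.mulVec, dotProduct]
  exact Finset.sum_congr rfl fun j _ => by rw [projPerp_apply_comm n j i]

/-- The test-vector side of the mode identity: `Σⱼ (Σ_{iab} 𝔹 i a j b ℓ_a ℓ_b qᵢ) yⱼ = Σᵢ qᵢ (Σ(𝔹,ℓ) y)ᵢ`. [folklore] -/
theorem sum_symb_mul_eq (𝔹 : Torus.Visc4 (Fin 3)) (ℓ : Fin 3 → ℤ) (q y : Fin 3 → ℝ) :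
    ∑ j, (∑ i, ∑ a, ∑ b, 𝔹 i a j b * (ℓ a : ℝ) * (ℓ b : ℝ) * q i) * y j = ∑ i, q i * (sigMat 𝔹 (kvec ℓ)).mulVec y i := by
  simp only [sigMat, kvec, Matrix.mulVec, dotProduct, Finset.sum_mul, Finset.mul_sum]
  rw [Finset.sum_comm]
  refine Finset.sum_congr rfl fun i _ => Finset.sum_congr rfl fun j _ => ?_
  refine Finset.sum_congr rfl fun a _ => Finset.sum_congr rfl fun b _ => ?_
  ring

end Generator


section Projected

variable {𝔹 : Torus.Visc4 (Fin 3)} {ℓ : Fin 3 → ℤ} {T' : ℝ}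

/-- **From the projected weak equation to the integrated ODE with the effective generator.**  A family `X : (0,T') → ℝ³` which is
transversal a.e., tested against the three columns of `P_ℓ` as in `effective_mode_identity_re_im`, with transversal datum `X₀`, satisfies
`X(t) = X₀ − ∫₀ᵗ Ḡ X` componentwise for a.e. `t`. [folklore] -/
theorem integral_eq_effGen_of_projected {X : ℝ → Fin 3 → ℝ} {X₀ : Fin 3 → ℝ}
    (htr : ∀ᵐ τ ∂(volume.restrict (Ioo 0 T')), ∑ j, (ℓ j : ℝ) * X τ j = 0) (htr₀ : ∑ j, (ℓ j : ℝ) * X₀ j = 0)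
    (hid : ∀ᵐ t ∂(volume.restrict (Ioo 0 T')), ∀ i,
      ∑ j, projPerp (khat ℓ) j i * X t j = ∑ j, projPerp (khat ℓ) j i * X₀ j - ∫ τ in (0:ℝ)..t, 4 * Real.pi ^ 2 *
        ∑ j, (∑ i', ∑ a, ∑ b, 𝔹 i' a j b * (ℓ a : ℝ) * (ℓ b : ℝ) * projPerp (khat ℓ) i' i) * X τ j) :
    ∀ᵐ t ∂(volume.restrict (Ioo 0 T')), ∀ i, X t i = X₀ i - ∫ τ in (0:ℝ)..t, (effGen 𝔹 ℓ).mulVec (X τ) i := by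
  have hP : ∀ᵐ τ ∂(volume.restrict (Ioo 0 T')), (projPerp (khat ℓ)).mulVec (X τ) = X τ := by
    filter_upwards [htr] with τ hτ
    exact projPerp_mulVec_of_perp (sum_khat_mul_eq_zero hτ)
  have hP' := (ae_restrict_iff' measurableSet_Ioo).1 hP
  have hP₀ : (projPerp (khat ℓ)).mulVec X₀ = X₀ := projPerp_mulVec_of_perp (sum_khat_mul_eq_zero htr₀)
  filter_upwards [hid, hP, ae_restrict_mem measurableSet_Ioo] with t ht hPt htT
  intro i
  have h := ht i
  rw [sum_projPerp_col_mul, sum_projPerp_col_mul, hPt, hP₀] at h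
  rw [h]
  congr 1
  refine intervalIntegral.integral_congr_ae ?_
  filter_upwards [hP'] with τ hτ hτmem
  have hτ' : τ ∈ Ioo 0 T' := by
    rw [uIoc_of_le htT.1.le] at hτmem
    exact ⟨hτmem.1, lt_of_le_of_lt hτmem.2 htT.2⟩
  rw [sum_symb_mul_eq, sum_projPerp_col_mul, effGen, Matrix.smul_mulVec, Pi.smul_apply, smul_eq_mul,
    ← Matrix.mulVec_mulVec, ← Matrix.mulVec_mulVec, hτ hτ']

end Projected

end Summit.AnomalousDissipation.AnomalousDissipation.Theorems.SolenoidalFractalHomogenisation.LagrangianStep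

end
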